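/-
Copyright (c) 2026. All rights reserved.
Released under Apache 2.0 license as described in the file LICENSE.
Authors: abc-iut cell, wave-4 prover seat abc-iut-w4-d050 (proof-only bridge over abc-iut-L5-t1's
`GlobalFrobenioidsModel.lean` and layer L1's [FrdI] Thm 5.2 (ii) `ModelFrobenioidIsFrobenioid.lean`).
-/
import Literature.IUT.HodgeTheaters.GlobalFrobenioidsModel
import Literature.AlgebraicGeometry.Frobenioids.ModelFrobenioidIsFrobenioid
import Literature.AlgebraicGeometry.Frobenioids.NumberFieldLocalizationCategoriesProofs
import HarnessLib

/-!
# [IUTchI] Example 5.1 (ii)/(iii): the model global Frobenioid `ℱ^⊛(†𝒟^⊚)` IS a Frobenioid (L1 ⟶ L5 bridge)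

S. Mochizuki, *Inter-universal Teichmüller theory I*, §5, Example 5.1 (ii) (kurims manuscript, May
2020, p. 125): "this data determines, by applying [FrdI], Theorem 5.2, (ii), a *model Frobenioid*
`ℱ^⊛(†𝒟^⊚)` over the base category `†𝒟^⊛`", and (iii) (p. 125): "`†ℱ^⊛` is equipped with a natural
Frobenioid structure".  Seat abc-iut-L5-t1 typed (ii) STATEMENTS-FIRST (`GlobalFrobenioidsModel.lean`,
p404939): `†𝒟^⊛ := ℬ(π₁(†𝒟^⊛))⁰` is the REAL category `BaseCat G = ConnectedPart (BCat G)`, the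
divisor data `(Φ^⊛, 𝔹, div)` is the interface `GlobalDivisorData G`, and
`ℱ^⊛(†𝒟^⊚) := ModelFrobenioid Δ.Φ Δ.B Δ.div` is layer L1's REAL [FrdI] Thm 5.2 (i) category — but the
Frobenioid STRUCTURE was left as data.

This PROOF-ONLY companion closes that gap as far as the tree allows, by instantiating L1's LANDED
[FrdI] Thm 5.2 (ii) (`ModelFrobenioid.isFrobenioid`, `ModelFrobenioidIsFrobenioid.lean`):

* the two BASE-CATEGORY hypotheses of [FrdI] Thm 5.2 — `𝒟` connected and totally epimorphic
  ([FrdI] Def 1.1 (iv)) — are DISCHARGED unconditionally for `†𝒟^⊛ = ℬ(G)⁰`, `G` any profinite group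
  (`isGraphConnected_baseCat`, `isTotallyEpimorphic_baseCat`; the latter is L1's
  `NFLocCat.isTotallyEpimorphic_connectedPart`, the former via the one-point object of
  `NFLocCat.exists_point_obj`);
* hence `ℱ^⊛(†𝒟^⊚) → F_{Φ^⊛}` is a Frobenioid of isotropic type as soon as the divisor data satisfy the
  printed hypotheses of [FrdI] Thm 5.2 — `Φ^⊛` a divisorial monoid, `𝔹` a group-like monoid on `†𝒟^⊛`
  (which is what [FrdI] Ex 6.3, the source of `(Φ^⊛, 𝔹, div)`, provides; these stay hypotheses BY NAME
  here because `GlobalDivisorData` deliberately carries no such fields)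
  (`GlobalDivisorData.isFrobenioid_model`, `GlobalDivisorData.isOfIsotropicType_model`).

Theorems only; no new definitions, no new named facts; nothing here bears on [IUTchIII] Cor. 3.12.
[claim: Mochizuki2012, status: disputed] for the [IUTchI] reading; the mathematics used is L1's
kernel-checked [FrdI] Thm 5.2 (ii) [cite: MochizukiFrdI2008, Thm. 5.2(ii) p.101].
-/

namespace Literature.IUT.HodgeTheaters

open CategoryTheory Literature.AlgebraicGeometry.Frobenioids

universe u

/-! ### `†𝒟^⊛ = ℬ(G)⁰` satisfies the base-category hypotheses of [FrdI] Thm 5.2 -/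

/-- `†𝒟^⊛ = ℬ(π₁(†𝒟^⊛))⁰` is CONNECTED in the sense of [FrdI] §0 (p. 16): it contains the one-point
`G`-set, which receives a morphism from every connected finite `G`-set, so any two objects are joined
by a zigzag. ([IUTchI] Ex 5.1 (ii) p.125; [FrdI] Def 1.1 (iv)) [claim: Mochizuki2012, status: disputed] -/
theorem isGraphConnected_baseCat (G : ProfiniteGrp.{u}) : IsGraphConnected (BaseCat G) := by
  obtain ⟨T, t₀, hT, ht⟩ := NFLocCat.exists_point_obj G
  have hpt : ∀ a b : T.obj.V, a = b := fun a b => (ht a).trans (ht b).symm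
  have toT : ∀ X : BaseCat G, Nonempty (X ⟶ (⟨T, hT⟩ : BaseCat G)) := fun X =>
    ⟨ObjectProperty.homMk (ObjectProperty.homMk
      { hom := FintypeCat.homMk fun _ => t₀
        comm := fun _ => FintypeCat.hom_ext _ _ fun _ => hpt _ _ })⟩
  refine ⟨⟨⟨T, hT⟩⟩, fun X Y => ?_⟩
  exact (Zigzag.of_hom (toT X).some).trans (Zigzag.of_inv (toT Y).some)

/-- `†𝒟^⊛ = ℬ(π₁(†𝒟^⊛))⁰` is TOTALLY EPIMORPHIC ([FrdI] §0): L1's `NFLocCat.isTotallyEpimorphic_connectedPart`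
at the profinite group `G`. ([IUTchI] Ex 5.1 (ii) p.125; [FrdI] Def 1.1 (iv)) [claim: Mochizuki2012, status: disputed] -/
theorem isTotallyEpimorphic_baseCat (G : ProfiniteGrp.{u}) : IsTotallyEpimorphic (BaseCat G) :=
  NFLocCat.isTotallyEpimorphic_connectedPart G

/-! ### `ℱ^⊛(†𝒟^⊚)` is a Frobenioid ([FrdI] Thm 5.2 (ii) applied, as print p. 125 says) -/

namespace GlobalDivisorData

variable {G : ProfiniteGrp.{u}} (Δ : GlobalDivisorData G)

/-- **[IUTchI] Ex 5.1 (ii), the Frobenioid structure of `ℱ^⊛(†𝒟^⊚)`** ("by applying [FrdI], Theorem 5.2,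
(ii), a model Frobenioid `ℱ^⊛(†𝒟^⊚)` over the base category `†𝒟^⊛`", p. 125): for divisor data on
`†𝒟^⊛ = ℬ(G)⁰` with `Φ^⊛` a divisorial monoid and `𝔹` a group-like monoid (the printed hypotheses of
[FrdI] Thm 5.2, supplied in print by [FrdI] Ex 6.3), the structure functor
`ℱ^⊛(†𝒟^⊚) → F_{Φ^⊛}` IS a Frobenioid — L1's `ModelFrobenioid.isFrobenioid` with its two base-category
hypotheses discharged by `isGraphConnected_baseCat` / `isTotallyEpimorphic_baseCat`.
([IUTchI] Ex 5.1 (ii) p.125) [claim: Mochizuki2012, status: disputed] -/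
theorem isFrobenioid_model (hΦ : IsMonoidOn Δ.Φ)
    (hΦd : Objectwise (fun M _ => IsDivisorial M) Δ.Φ) (hB : IsMonoidOn Δ.B)
    (hBg : Objectwise (fun M _ => IsGroupLike M) Δ.B) :
    PreFrobenioid.IsFrobenioid (ModelFrobenioid.toElem Δ.Φ Δ.B Δ.div) :=
  ModelFrobenioid.isFrobenioid hΦ hΦd hB hBg (isGraphConnected_baseCat G) (isTotallyEpimorphic_baseCat G)

/-- `ℱ^⊛(†𝒟^⊚) → F_{Φ^⊛}` is of ISOTROPIC type ([FrdI] Thm 5.2 (ii): "of isotropic … type") whenever `𝔹`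
is group-like — L1's `ModelFrobenioid.isOfIsotropicType` at the global divisor data.
([IUTchI] Ex 5.1 (ii) p.125) [claim: Mochizuki2012, status: disputed] -/
theorem isOfIsotropicType_model (hBg : Objectwise (fun M _ => IsGroupLike M) Δ.B) :
    PreFrobenioid.IsOfIsotropicType (ModelFrobenioid.toElem Δ.Φ Δ.B Δ.div) :=
  ModelFrobenioid.isOfIsotropicType hBg

end GlobalDivisorData

end Literature.IUT.HodgeTheaters
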